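import Summits.NavierStokesRegularity.NavierStokesRegularity.Theses.CorkscrewDynamo
import Summits.NavierStokesRegularity.NavierStokesRegularity.Theorems.TypeIDSSLiouvilleConjecture

/-!
# Route CorkscrewDynamo · crux `CorkscrewProfile` (stmt-NavierStokesRegularity-11282) — the negative record modulo the wall

`CorkscrewProfile` (a nontrivial Type-I ancient mild solution, rotated `λ`-DSS about `e₃` with ESSENTIAL
rotation) is, in particular, a counterexample to the canonical open conjecture
`Summit.NavierStokesRegularity.NavierStokesRegularity.TypeIDSSLiouvilleConjecture` (the Type-I rotated DSS
Liouville wall: Tsai GSM 192 Conj. 8.8–8.9 = Bradshaw–Tsai 2017 Open Problem 5.1), whose rotated half says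
that every Type-I rotated `λ`-DSS ancient mild solution with measurable slices vanishes a.e. on every past
slice. Hence `TypeIDSSLiouvilleConjecture → ¬ CorkscrewProfile`: the crux is refuted by the wall and by
nothing weaker that is presently a tree theorem (the route's kill criterion (i), typed). The essential-rotation
clause is not used: the wall already kills the nontriviality clause.
-/

namespace Summit.NavierStokesRegularity.NavierStokesRegularity.Theorems.CorkscrewProfile.Negative

set_option linter.dupNamespace false

/-- **`¬ CorkscrewProfile` modulo the Type-I DSS Liouville wall.** If
`TypeIDSSLiouvilleConjecture` holds (for every factor `c` and every linear isometry `R`, Type-I rotated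
`c`-DSS ancient mild solutions with measurable slices vanish a.e. on `t < 0`), then route `CorkscrewDynamo`'s
crux `CorkscrewProfile` fails: its witness `(c, θ, R, u)` is such a solution and is nontrivial. -/
theorem CorkscrewProfile_false_of_TypeIDSSLiouvilleConjecture :
    Summit.NavierStokesRegularity.NavierStokesRegularity.TypeIDSSLiouvilleConjecture →
      ¬ Summit.NavierStokesRegularity.NavierStokesRegularity.Theses.CorkscrewDynamo.CorkscrewProfile := by
  intro hW hP
  obtain ⟨c, θ, R, u, hc, -, hmild, hmeas, hrdss, hC, -, hnz⟩ := hP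
  exact hnz ((hW c).2 R hc u hmild hmeas hrdss hC)

/-- **A corkscrew refutes the wall** (contrapositive form, the first line of the route's deciding theorem
read negatively): `CorkscrewProfile → ¬ TypeIDSSLiouvilleConjecture`. -/
theorem not_typeIDSSLiouvilleConjecture_of_corkscrewProfile
    (hP : Summit.NavierStokesRegularity.NavierStokesRegularity.Theses.CorkscrewDynamo.CorkscrewProfile) :
    ¬ Summit.NavierStokesRegularity.NavierStokesRegularity.TypeIDSSLiouvilleConjecture :=
  fun hW => CorkscrewProfile_false_of_TypeIDSSLiouvilleConjecture hW hP

end Summit.NavierStokesRegularity.NavierStokesRegularity.Theorems.CorkscrewProfile.Negative
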